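import Mathlib
import Summits.Ventures.PercRepro2.ZMeanProof
import Summits.Ventures.PercRepro2.PendantRoot
import Summits.Ventures.PercRepro2.PocketTransport
import Summits.Ventures.PercRepro2.PocketBHK
import Summits.Ventures.PercRepro2.HMFPendantO
import Summits.Ventures.PercRepro2.HMFTwoRootMass
import Summits.Ventures.PercRepro2.StarGlue
import Summits.Ventures.PercRepro2.StarOEvents
import Summits.Ventures.PercRepro2.StarOProb
import Summits.Ventures.PercRepro2.StarOXhatA

/-!
# The three-coin star at `a₃` (class O): the mean field `X̂`, part 2 (the row sums)
(blind cell PercRepro2, night-1 g8; NIGHT1-G8.md §4; part 1 = `StarOXhatA.lean`)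

`X̂ = r̄ [ᾱβ̄ · termPD{a₃} + αβ̄ · Y_T′ + βᾱ · Y_T]` (`Xhat_star3`): the rows with the `o`-coin open or
both root coins open vanish, the all-closed row is the isolated term, and the `f₁`- / `f₂`-rows,
reindexed by `W ↦ W.erase a₃`, are the light / heavy row sums (`PocketBHK.mfT_le`'s form) at the
star-zeroed weights.
-/

namespace Summit.Ventures.PercRepro2

open StarGlue PendantRoot UnionCluster

namespace StarO

section Xhat

variable {V : Type*} {E : Type*} [Fintype E] [DecidableEq E] [Fintype V] [DecidableEq V]
  {R : Type*} [Field R] [LinearOrder R] [IsStrictOrderedRing R]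

variable (p : E → R) (ends : E → Sym2 V) {f₁ f₂ f₃ : E} {a₃ a₁ a₂ o b : V}

/-- The heavy row sum `Σ_W P(Q, C(a₂) = W) termT(W, o, a₁, b)` (the form of `PocketBHK.mfT_le`). -/
noncomputable def heavySum (q : E → R) (o a₁ a₂ b : V) : R :=
  ∑ W : Finset V, prob q ((connEvent ends a₁ a₂)ᶜ ∩ clusterEvent ends a₂ (↑W : Set V)) *
    termT q ends W o a₁ b

omit [LinearOrder R] [IsStrictOrderedRing R] in
/-- The star closed through the finset coercion is `closeStar`. -/
lemma restrict_toFinset_eq (ω : Config E) :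
    restrict (↑(touches ends {a₃}).toFinset : Set E)ᶜ ω = restrict (touches ends {a₃})ᶜ ω := by
  funext e
  by_cases h : e ∈ touches ends {a₃}
  · rw [restrict_apply_of_notMem (show e ∉ (↑(touches ends {a₃}).toFinset : Set E)ᶜ from
        fun h' => h' (by simpa using h)),
      restrict_apply_of_notMem (show e ∉ (touches ends {a₃})ᶜ from fun h' => h' h)]
  · rw [restrict_apply_of_mem (show e ∈ (↑(touches ends {a₃}).toFinset : Set E)ᶜ from
        fun h' => h (by simpa using h')),
      restrict_apply_of_mem (show e ∈ (touches ends {a₃})ᶜ from h)]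

omit [LinearOrder R] [IsStrictOrderedRing R] in
/-- Under the star-zeroed weights no cluster of a vertex other than `a₃` contains `a₃`. -/
lemma prob_pOut_clusterEvent_of_mem {x : V} (hx : x ≠ a₃) {W : Finset V} (h3 : a₃ ∈ W) :
    prob (pOut p ends a₃) (clusterEvent ends x (↑W : Set V)) = 0 := by
  unfold pOut
  rw [PocketConn.prob_zeroOn]
  have : {ω : Config E | PocketConn.closeOn (touches ends {a₃}).toFinset ω ∈
      clusterEvent ends x (↑W : Set V)} = ∅ := by
    ext ω
    simp only [Set.mem_setOf_eq, mem_clusterEvent, Set.mem_empty_iff_false, iff_false]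
    intro h
    have h3' : a₃ ∈ cluster ends (PocketConn.closeOn (touches ends {a₃}).toFinset ω) x := by
      rw [h]; exact Finset.mem_coe.2 h3
    rw [PocketConn.closeOn_eq_restrict, restrict_toFinset_eq] at h3'
    exact not_conn_closeStar hx h3'
  rw [this, prob_empty]

omit [LinearOrder R] [IsStrictOrderedRing R] in
/-- The rows of the star-zeroed cluster of `a₂`, weighted by `termW`, are the heavy row sum. -/
lemma sum_cluster_termW_eq_heavySum :
    ∑ W : Finset V, prob (pOut p ends a₃) (clusterEvent ends a₂ (↑W : Set V)) *
        termW (pOut p ends a₃) ends o a₁ a₂ b W = heavySum ends (pOut p ends a₃) o a₁ a₂ b := by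
  unfold heavySum
  refine Finset.sum_congr rfl fun W _ => ?_
  by_cases h2 : a₂ ∈ W
  · by_cases h1 : a₁ ∈ W
    · have e : (connEvent ends a₁ a₂)ᶜ ∩ clusterEvent ends a₂ (↑W : Set V) = ∅ := by
        ext ω
        simp only [Set.mem_inter_iff, Set.mem_compl_iff, mem_connEvent, mem_clusterEvent,
          Set.mem_empty_iff_false, iff_false, not_and]
        intro hQ hW
        apply hQ
        have : a₁ ∈ cluster ends ω a₂ := by rw [hW]; exact Finset.mem_coe.2 h1
        exact conn_symm this
      rw [e, prob_empty, zero_mul]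
      simp [termW, h1, h2]
    · have e : (connEvent ends a₁ a₂)ᶜ ∩ clusterEvent ends a₂ (↑W : Set V) =
          clusterEvent ends a₂ (↑W : Set V) := by
        ext ω
        simp only [Set.mem_inter_iff, Set.mem_compl_iff, mem_connEvent, mem_clusterEvent,
          and_iff_right_iff_imp]
        intro hW h
        have : a₁ ∈ cluster ends ω a₂ := conn_symm h
        rw [hW] at this
        exact h1 (Finset.mem_coe.1 this)
      rw [e]
      simp [termW, h1, h2]
  · have e : clusterEvent ends a₂ (↑W : Set V) = ∅ := by
      ext ω
      simp only [mem_clusterEvent, Set.mem_empty_iff_false, iff_false]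
      intro hW
      exact h2 (Finset.mem_coe.1 (hW ▸ mem_cluster_self ends ω a₂))
    rw [e, Set.inter_empty, prob_empty, zero_mul, zero_mul]

omit [LinearOrder R] [IsStrictOrderedRing R] in
/-- The `f₂`-rows of `X̂`: reindexed by `W ↦ W.erase a₃`, they are the heavy row sum at the
star-zeroed weights. -/
lemma sum_f2_rows (hf₁ : ends f₁ = s(a₃, a₁)) (hf₂ : ends f₂ = s(a₃, a₂))
    (hf₃ : ends f₃ = s(a₃, o)) (hstar : ∀ e, a₃ ∈ ends e → e = f₁ ∨ e = f₂ ∨ e = f₃)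
    (h31 : a₃ ≠ a₁) (h32 : a₃ ≠ a₂) (h3o : a₃ ≠ o) (h3b : a₃ ≠ b) (h12 : f₁ ≠ f₂) (h13 : f₁ ≠ f₃)
    (h23 : f₂ ≠ f₃) :
    ∑ W : Finset V, prob p (clusterEvent ends a₃ (↑W : Set V) ∩ outc f₁ f₂ f₃ false true false) *
        termW p ends o a₁ a₂ b W =
      (1 - p f₁) * p f₂ * (1 - p f₃) * heavySum ends (pOut p ends a₃) o a₁ a₂ b := by
  have hf1 : a₃ ∈ ends f₁ := by rw [hf₁]; exact Sym2.mem_mk_left _ _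
  have hf2 : a₃ ∈ ends f₂ := by rw [hf₂]; exact Sym2.mem_mk_left _ _
  have hf3 : a₃ ∈ ends f₃ := by rw [hf₃]; exact Sym2.mem_mk_left _ _
  have fac : ∀ (A : Set (Config E)),
      prob p (viaStar ends a₃ A ∩ outc f₁ f₂ f₃ false true false) =
        prob (pOut p ends a₃) A * (1 - p f₁) * p f₂ * (1 - p f₃) := by
    intro A
    rw [prob_inter_outc p h12 h13 h23 (free_viaStar ends a₃ hf1 A) (free_viaStar ends a₃ hf2 A)
      (free_viaStar ends a₃ hf3 A), prob_viaStar]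
    simp [cw]
  simp only [clusterEvent_a3_inter_outc_f2 ends hf₁ hf₂ hf₃ hstar h31 h32 h3o]
  rw [← sum_cluster_termW_eq_heavySum p ends, Finset.mul_sum]
  set F : Finset V → R := fun W => prob p (if a₃ ∈ W then
    viaStar ends a₃ (clusterEvent ends a₂ (↑(W.erase a₃) : Set V)) ∩ outc f₁ f₂ f₃ false true false
    else ∅) * termW p ends o a₁ a₂ b W with hF
  set G : Finset V → R := fun W => (1 - p f₁) * p f₂ * (1 - p f₃) *
    (prob (pOut p ends a₃) (clusterEvent ends a₂ (↑W : Set V)) *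
      termW (pOut p ends a₃) ends o a₁ a₂ b W) with hG
  have hL := Finset.sum_filter_add_sum_filter_not Finset.univ (fun W : Finset V => a₃ ∈ W) F
  have hR := Finset.sum_filter_add_sum_filter_not Finset.univ (fun W : Finset V => a₃ ∈ W) G
  have hL0 : ∑ W ∈ Finset.univ.filter (fun W : Finset V => ¬ a₃ ∈ W), F W = 0 := by
    refine Finset.sum_eq_zero fun W hW => ?_
    simp only [hF, if_neg (Finset.mem_filter.1 hW).2, prob_empty, zero_mul]
  have hR0 : ∑ W ∈ Finset.univ.filter (fun W : Finset V => a₃ ∈ W), G W = 0 := by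
    refine Finset.sum_eq_zero fun W hW => ?_
    simp only [hG, prob_pOut_clusterEvent_of_mem p ends h32.symm (Finset.mem_filter.1 hW).2,
      zero_mul, mul_zero]
  show ∑ W, F W = ∑ W, G W
  rw [← hL, ← hR, hL0, hR0, add_zero, zero_add]
  refine Finset.sum_bij' (fun W _ => W.erase a₃) (fun W' _ => insert a₃ W') ?_ ?_ ?_ ?_ ?_
  · intro W hW
    simp only [Finset.mem_filter, Finset.mem_univ, true_and, Finset.mem_erase, ne_eq,
      not_true_eq_false, false_and, not_false_eq_true]
  · intro W' hW'
    simp only [Finset.mem_filter, Finset.mem_univ, true_and, Finset.mem_insert, true_or]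
  · intro W hW
    exact Finset.insert_erase (Finset.mem_filter.1 hW).2
  · intro W' hW'
    exact Finset.erase_insert (Finset.mem_filter.1 hW').2
  · intro W hW
    have h3W : a₃ ∈ W := (Finset.mem_filter.1 hW).2
    simp only [hF, hG, if_pos h3W, fac]
    have : W = insert a₃ (W.erase a₃) := (Finset.insert_erase h3W).symm
    conv_lhs => rw [this]
    rw [termW_insert_a3 p ends (W.erase a₃) h31 h32 h3o h3b, Finset.erase_insert
      (Finset.notMem_erase a₃ W)]
    ring

/-- The light row sum `Σ_W P(Q, C(a₁) = W) termT(W, o, a₂, b)` (`PocketBHK.mfT_le` with the roots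
swapped). -/
noncomputable def lightSum (q : E → R) (o a₁ a₂ b : V) : R :=
  ∑ W : Finset V, prob q ((connEvent ends a₂ a₁)ᶜ ∩ clusterEvent ends a₁ (↑W : Set V)) *
    termT q ends W o a₂ b

omit [LinearOrder R] [IsStrictOrderedRing R] in
/-- The rows of the star-zeroed cluster of `a₁`, weighted by `termW`, are the light row sum. -/
lemma sum_cluster_termW_eq_lightSum :
    ∑ W : Finset V, prob (pOut p ends a₃) (clusterEvent ends a₁ (↑W : Set V)) *
        termW (pOut p ends a₃) ends o a₁ a₂ b W = lightSum ends (pOut p ends a₃) o a₁ a₂ b := by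
  unfold lightSum
  refine Finset.sum_congr rfl fun W _ => ?_
  by_cases h1 : a₁ ∈ W
  · by_cases h2 : a₂ ∈ W
    · have e : (connEvent ends a₂ a₁)ᶜ ∩ clusterEvent ends a₁ (↑W : Set V) = ∅ := by
        ext ω
        simp only [Set.mem_inter_iff, Set.mem_compl_iff, mem_connEvent, mem_clusterEvent,
          Set.mem_empty_iff_false, iff_false, not_and]
        intro hQ hW
        apply hQ
        have : a₂ ∈ cluster ends ω a₁ := by rw [hW]; exact Finset.mem_coe.2 h2
        exact conn_symm this
      rw [e, prob_empty, zero_mul]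
      simp [termW, h1, h2]
    · have e : (connEvent ends a₂ a₁)ᶜ ∩ clusterEvent ends a₁ (↑W : Set V) =
          clusterEvent ends a₁ (↑W : Set V) := by
        ext ω
        simp only [Set.mem_inter_iff, Set.mem_compl_iff, mem_connEvent, mem_clusterEvent,
          and_iff_right_iff_imp]
        intro hW h
        have : a₂ ∈ cluster ends ω a₁ := conn_symm h
        rw [hW] at this
        exact h2 (Finset.mem_coe.1 this)
      rw [e]
      simp [termW, h1, h2]
  · have e : clusterEvent ends a₁ (↑W : Set V) = ∅ := by
      ext ω
      simp only [mem_clusterEvent, Set.mem_empty_iff_false, iff_false]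
      intro hW
      exact h1 (Finset.mem_coe.1 (hW ▸ mem_cluster_self ends ω a₁))
    rw [e, Set.inter_empty, prob_empty, zero_mul, zero_mul]

omit [LinearOrder R] [IsStrictOrderedRing R] in
/-- The `f₁`-rows of `X̂`: the light row sum at the star-zeroed weights. -/
lemma sum_f1_rows (hf₁ : ends f₁ = s(a₃, a₁)) (hf₂ : ends f₂ = s(a₃, a₂))
    (hf₃ : ends f₃ = s(a₃, o)) (hstar : ∀ e, a₃ ∈ ends e → e = f₁ ∨ e = f₂ ∨ e = f₃)
    (h31 : a₃ ≠ a₁) (h32 : a₃ ≠ a₂) (h3o : a₃ ≠ o) (h3b : a₃ ≠ b) (h12 : f₁ ≠ f₂) (h13 : f₁ ≠ f₃)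
    (h23 : f₂ ≠ f₃) :
    ∑ W : Finset V, prob p (clusterEvent ends a₃ (↑W : Set V) ∩ outc f₁ f₂ f₃ true false false) *
        termW p ends o a₁ a₂ b W =
      p f₁ * (1 - p f₂) * (1 - p f₃) * lightSum ends (pOut p ends a₃) o a₁ a₂ b := by
  have hf1 : a₃ ∈ ends f₁ := by rw [hf₁]; exact Sym2.mem_mk_left _ _
  have hf2 : a₃ ∈ ends f₂ := by rw [hf₂]; exact Sym2.mem_mk_left _ _
  have hf3 : a₃ ∈ ends f₃ := by rw [hf₃]; exact Sym2.mem_mk_left _ _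
  have fac : ∀ (A : Set (Config E)),
      prob p (viaStar ends a₃ A ∩ outc f₁ f₂ f₃ true false false) =
        prob (pOut p ends a₃) A * p f₁ * (1 - p f₂) * (1 - p f₃) := by
    intro A
    rw [prob_inter_outc p h12 h13 h23 (free_viaStar ends a₃ hf1 A) (free_viaStar ends a₃ hf2 A)
      (free_viaStar ends a₃ hf3 A), prob_viaStar]
    simp [cw]
  simp only [clusterEvent_a3_inter_outc_f1 ends hf₁ hf₂ hf₃ hstar h31 h32 h3o]
  rw [← sum_cluster_termW_eq_lightSum p ends, Finset.mul_sum]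
  set F : Finset V → R := fun W => prob p (if a₃ ∈ W then
    viaStar ends a₃ (clusterEvent ends a₁ (↑(W.erase a₃) : Set V)) ∩ outc f₁ f₂ f₃ true false false
    else ∅) * termW p ends o a₁ a₂ b W with hF
  set G : Finset V → R := fun W => p f₁ * (1 - p f₂) * (1 - p f₃) *
    (prob (pOut p ends a₃) (clusterEvent ends a₁ (↑W : Set V)) *
      termW (pOut p ends a₃) ends o a₁ a₂ b W) with hG
  have hL := Finset.sum_filter_add_sum_filter_not Finset.univ (fun W : Finset V => a₃ ∈ W) F
  have hR := Finset.sum_filter_add_sum_filter_not Finset.univ (fun W : Finset V => a₃ ∈ W) G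
  have hL0 : ∑ W ∈ Finset.univ.filter (fun W : Finset V => ¬ a₃ ∈ W), F W = 0 := by
    refine Finset.sum_eq_zero fun W hW => ?_
    simp only [hF, if_neg (Finset.mem_filter.1 hW).2, prob_empty, zero_mul]
  have hR0 : ∑ W ∈ Finset.univ.filter (fun W : Finset V => a₃ ∈ W), G W = 0 := by
    refine Finset.sum_eq_zero fun W hW => ?_
    simp only [hG, prob_pOut_clusterEvent_of_mem p ends h31.symm (Finset.mem_filter.1 hW).2,
      zero_mul, mul_zero]
  show ∑ W, F W = ∑ W, G W
  rw [← hL, ← hR, hL0, hR0, add_zero, zero_add]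
  refine Finset.sum_bij' (fun W _ => W.erase a₃) (fun W' _ => insert a₃ W') ?_ ?_ ?_ ?_ ?_
  · intro W hW
    simp only [Finset.mem_filter, Finset.mem_univ, true_and, Finset.mem_erase, ne_eq,
      not_true_eq_false, false_and, not_false_eq_true]
  · intro W' hW'
    simp only [Finset.mem_filter, Finset.mem_univ, true_and, Finset.mem_insert, true_or]
  · intro W hW
    exact Finset.insert_erase (Finset.mem_filter.1 hW).2
  · intro W' hW'
    exact Finset.erase_insert (Finset.mem_filter.1 hW').2
  · intro W hW
    have h3W : a₃ ∈ W := (Finset.mem_filter.1 hW).2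
    simp only [hF, hG, if_pos h3W, fac]
    have : W = insert a₃ (W.erase a₃) := (Finset.insert_erase h3W).symm
    conv_lhs => rw [this]
    rw [termW_insert_a3 p ends (W.erase a₃) h31 h32 h3o h3b, Finset.erase_insert
      (Finset.notMem_erase a₃ W)]
    ring

omit [LinearOrder R] [IsStrictOrderedRing R] in
/-- Rows with the `o`-coin open carry no mean-field weight. -/
lemma sum_f3_rows_zero (hf₃ : ends f₃ = s(a₃, o)) (b₁ b₂ : Bool) :
    ∑ W : Finset V, prob p (clusterEvent ends a₃ (↑W : Set V) ∩ outc f₁ f₂ f₃ b₁ b₂ true) *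
        termW p ends o a₁ a₂ b W = 0 := by
  refine Finset.sum_eq_zero fun W _ => ?_
  by_cases hoW : o ∈ W
  · rw [HMFPendantO.termW_eq_zero_of_mem p ends hoW, mul_zero]
  · rw [clusterEvent_a3_inter_outc_f3 ends hf₃ hoW, prob_empty, zero_mul]

omit [LinearOrder R] [IsStrictOrderedRing R] in
/-- Rows with both root coins open carry no mean-field weight. -/
lemma sum_f12_rows_zero (hf₁ : ends f₁ = s(a₃, a₁)) (hf₂ : ends f₂ = s(a₃, a₂)) (b₃ : Bool) :
    ∑ W : Finset V, prob p (clusterEvent ends a₃ (↑W : Set V) ∩ outc f₁ f₂ f₃ true true b₃) *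
        termW p ends o a₁ a₂ b W = 0 := by
  refine Finset.sum_eq_zero fun W _ => ?_
  by_cases h : a₁ ∈ W ∧ a₂ ∈ W
  · simp [termW, h.1, h.2]
  · rw [clusterEvent_a3_inter_outc_f12 ends hf₁ hf₂ h, prob_empty, zero_mul]

omit [LinearOrder R] [IsStrictOrderedRing R] in
/-- The all-closed row is the isolated term. -/
lemma sum_ccc_rows (hf₁ : ends f₁ = s(a₃, a₁)) (hf₂ : ends f₂ = s(a₃, a₂))
    (hf₃ : ends f₃ = s(a₃, o)) (hstar : ∀ e, a₃ ∈ ends e → e = f₁ ∨ e = f₂ ∨ e = f₃)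
    (h31 : a₃ ≠ a₁) (h32 : a₃ ≠ a₂) (h3o : a₃ ≠ o) (h12 : f₁ ≠ f₂) (h13 : f₁ ≠ f₃) (h23 : f₂ ≠ f₃) :
    ∑ W : Finset V, prob p (clusterEvent ends a₃ (↑W : Set V) ∩ outc f₁ f₂ f₃ false false false) *
        termW p ends o a₁ a₂ b W =
      (1 - p f₁) * (1 - p f₂) * (1 - p f₃) * termW p ends o a₁ a₂ b {a₃} := by
  have hf1 : a₃ ∈ ends f₁ := by rw [hf₁]; exact Sym2.mem_mk_left _ _
  have hf2 : a₃ ∈ ends f₂ := by rw [hf₂]; exact Sym2.mem_mk_left _ _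
  have hf3 : a₃ ∈ ends f₃ := by rw [hf₃]; exact Sym2.mem_mk_left _ _
  have hw : prob p (outc f₁ f₂ f₃ false false false) = (1 - p f₁) * (1 - p f₂) * (1 - p f₃) := by
    have := prob_inter_outc p h12 h13 h23 (A := Set.univ) (fun _ _ _ => rfl) (fun _ _ _ => rfl)
      (fun _ _ _ => rfl) false false false
    rwa [Set.univ_inter, prob_univ, one_mul] at this
  simp only [clusterEvent_a3_inter_outc_ccc ends hf₁ hf₂ hf₃ hstar h31 h32 h3o]
  rw [Finset.sum_eq_single ({a₃} : Finset V)]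
  · rw [if_pos rfl, hw]
  · intro W _ hW
    rw [if_neg hW, prob_empty, zero_mul]
  · intro h; exact absurd (Finset.mem_univ _) h

omit [LinearOrder R] [IsStrictOrderedRing R] in
/-- **The mean field at the three-coin star**:
`X̂ = r̄ [ᾱβ̄ termW{a₃} + αβ̄ Y_T′ + βᾱ Y_T]` with the row sums at the star-zeroed weights. -/
theorem Xhat_star3 (hf₁ : ends f₁ = s(a₃, a₁)) (hf₂ : ends f₂ = s(a₃, a₂))
    (hf₃ : ends f₃ = s(a₃, o)) (hstar : ∀ e, a₃ ∈ ends e → e = f₁ ∨ e = f₂ ∨ e = f₃)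
    (h31 : a₃ ≠ a₁) (h32 : a₃ ≠ a₂) (h3o : a₃ ≠ o) (h3b : a₃ ≠ b) (h12 : f₁ ≠ f₂) (h13 : f₁ ≠ f₃)
    (h23 : f₂ ≠ f₃) :
    Xhat p ends o a₁ a₂ a₃ b =
      (1 - p f₁) * (1 - p f₂) * (1 - p f₃) * termW p ends o a₁ a₂ b {a₃} +
        p f₁ * (1 - p f₂) * (1 - p f₃) * lightSum ends (pOut p ends a₃) o a₁ a₂ b +
        (1 - p f₁) * p f₂ * (1 - p f₃) * heavySum ends (pOut p ends a₃) o a₁ a₂ b := by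
  rw [Xhat_eq_sum]
  have hsplit : ∀ W : Finset V, prob p (clusterEvent ends a₃ (↑W : Set V)) * termW p ends o a₁ a₂ b W =
      ∑ b₁ : Bool, ∑ b₂ : Bool, ∑ b₃ : Bool,
        prob p (clusterEvent ends a₃ (↑W : Set V) ∩ outc f₁ f₂ f₃ b₁ b₂ b₃) * termW p ends o a₁ a₂ b W := by
    intro W
    rw [prob_eq_sum_outc p f₁ f₂ f₃ (clusterEvent ends a₃ (↑W : Set V))]
    simp only [Finset.sum_mul]
  simp only [hsplit, Fintype.sum_bool]
  simp only [Finset.sum_add_distrib]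
  rw [sum_f3_rows_zero p ends hf₃ true true, sum_f12_rows_zero p ends hf₁ hf₂ false,
    sum_f3_rows_zero p ends hf₃ true false, sum_f1_rows p ends hf₁ hf₂ hf₃ hstar h31 h32 h3o h3b h12 h13 h23,
    sum_f3_rows_zero p ends hf₃ false true, sum_f2_rows p ends hf₁ hf₂ hf₃ hstar h31 h32 h3o h3b h12 h13 h23,
    sum_f3_rows_zero p ends hf₃ false false, sum_ccc_rows p ends hf₁ hf₂ hf₃ hstar h31 h32 h3o h12 h13 h23]
  ring

end Xhat

end StarO

end Summit.Ventures.PercRepro2
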